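import Literature.MathematicalPhysics.QuantumLattice.HubbardTTPrimeThermalPressureLimit
import Literature.MathematicalPhysics.QuantumLattice.HubbardTTPrimeDoccTransportThermal
import HarnessLib

/-!
# Griffiths' lemma in numbers for the 2D `t–t'` Hubbard model at `T > 0`: the thermal double occupancy and
# the diagonal kinetic density of every torus-limit Gibbs state are bracketed by SLOPES OF THE PRESSURE, and
# pressure floors move across a coupling cell with a certified slope cap

Topic `MathematicalPhysics/QuantumLattice` (family `hubbard`); sequel of `HubbardTTPrimeThermalPressure.lean` /
`HubbardTTPrimeThermalPressureLimit.lean` (the numbers `p⁺ = pressureSupTT'`, `p⁻ = pressureInfTT'`, `p = pressureTT'`)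
and of `HubbardTTPrimeDoccTransportThermal.lean` / `HubbardTTPrimeDiagHopTransportThermal.lean` (the finite-volume
Peierls–Bogoliubov brackets `β(U₂−U₁)⟨D⟩_{U₂} ≤ log Z_L(U₁) − log Z_L(U₂) ≤ β(U₂−U₁)⟨D⟩_{U₁}` and the same along `t'`
with the diagonal kinetic term). The two-parameter tangent-plane lemma of the seat's row, on the temperature axis:

* §1 `U`-direction. For every torus limit `ω` of the canonical sector Gibbs states at `(β, t, s, U₀, n)` along any
  `Ls → ∞` (`β > 0`, `0 ≤ n < 2`, `h > 0`), with `D(ω) = e_{Φ(0,0,1)}(ω)` the thermal double-occupancy density: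
  `(p⁻(U₀) − p⁺(U₀+h))/(βh) ≤ D(ω) ≤ (p⁺(U₀−h) − p⁻(U₀))/(βh)`
  (`IsTorusLimitOfMixture.pressure_slope_le_docc_of_sectorGibbs`, `…docc_le_pressure_slope…`), and with the limit
  numbers `pressureTT'` when `U₀ ≥ 0` (resp. `U₀ − h ≥ 0`) — CERTIFIED THERMAL DOCC WINDOWS FROM THREE PRESSURES;
* §2 `t'`-direction: the same for the diagonal kinetic density `K₂(ω) = e_{Φ(0,1,0)}(ω)` with `p(β; t, s ± h, U)`;
* §3 PRESSURE TANGENTS (floor transport with a slope cap): if `D(ω) ≤ d⁺` for EVERY torus limit at `U₀` then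
  `p⁻(U₀) − β(U − U₀) d⁺ ≤ p⁻(U)` for all `U ≥ U₀`; if `d⁻ ≤ D(ω)` for every torus limit at `U₀` then
  `p⁻(U₀) + β(U₀ − U) d⁻ ≤ p⁻(U)` for all `U ≤ U₀`; the `t'` twins with `K₂`-caps/floors (e.g. the kinematic
  `|K₂| ≤ 4n`); number forms for `pressureTT'`. With the Jensen CAP of `HubbardTTPrimeThermalPressure` (§5) this is the
  complete `T > 0` box rule for pressures: ceilings by convexity, floors by tangents with certified slopes.

Everything is PROVED; no definition, no named fact.

## Mathlib / tree search

REUSED: `log_partitionFn_sector_sub_mem_Icc_U` (`HubbardTTPrimeDoccTransportThermal`), `log_partitionFn_sector_sub_mem_Icc_tPrime`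
(`HubbardTTPrimeDiagHopTransportThermal`), `IsTorusLimitOfMixture.tendsto_meanEnergy_hubbardTTPrime` (`TorusLimitOfMixtures`),
`eventually_re_sectorGibbsAvg_le_of_forall_torusLimit` / `…_ge_…` (`TorusLimitOfMixturesLimsup`),
`torusAvgExpect_hubbardTTPrime_meanEnergyObs` (`HubbardNNNHoppingTorusLimitCorrelator`), the dictionary lemmas
`eventually_sub_mul_sq_le_log_partitionFn_of_le_pressureInfTT'`, `eventually_log_partitionFn_le_add_mul_sq_of_pressureSupTT'_le`,
`le_pressureInfTT'_iff`, `pressure{Sup,Inf}TT'_eq_pressureTT'` (`HubbardTTPrimeThermalPressure{,Limit}`).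
`lean search 'pressure_slope|slope_le_docc'`: nothing (2026-08-27).

## References

* R. B. Griffiths, J. Math. Phys. 5 (1964) 1215 (convexity ⇒ derivative brackets). [cite: Griffiths1964, §2]
* E. H. Lieb, Adv. Math. 11 (1973) 267, §V (5.2)–(5.4) (Peierls–Bogoliubov). [cite: Lieb1973, §V (5.2)–(5.4)]
* R. B. Israel, *Convexity in the Theory of Lattice Gases* (1979), Thm. I.2.4, Lemma II.3.1. [cite: Israel1979, Lemma II.3.1]
-/

noncomputable section

namespace Literature.MathematicalPhysics.QuantumLattice

open Matrix Finset HubbardWave0 Literature.Probability.LatticeModels ThermodynamicLimit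
open _root_.Filter
open scoped _root_.Topology ComplexOrder BigOperators

namespace InfVolFermionState

variable {t s U₀ n β : ℝ} {ω : InfVolFermionState 2} {Ls : ℕ → ℕ}

/-! ### §1 The `U`-direction: thermal double occupancy from three pressures -/

/-- **Lower Griffiths bracket in `U`**: for every torus limit `ω` of the canonical sector Gibbs states of
`H(t,s,U₀)` at `β > 0` (`0 ≤ n < 2`) and every `h > 0`,
`(p⁻(β;t,s,U₀;n) − p⁺(β;t,s,U₀+h;n))/(βh) ≤ D(ω)`, `D(ω) = e_{Φ(0,0,1)}(ω)` the thermal double-occupancy density.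
[cite: Griffiths1964, §2] [cite: Lieb1973, §V (5.2)–(5.4)] -/
theorem IsTorusLimitOfMixture.pressure_slope_le_docc_of_sectorGibbs (hn0 : 0 ≤ n) (hn2 : n < 2) (hβ : 0 < β)
    (h : ω.IsTorusLimitOfMixture (sectorGibbsCount n) (fun L => sectorGibbsWeightTT' β t s U₀ n L)
      (fun L => sectorGibbsVectorTT' t s U₀ n L) Ls)
    (hLs : Tendsto Ls atTop atTop) {h' : ℝ} (hh : 0 < h') :
    (pressureInfTT' β t s U₀ n - pressureSupTT' β t s (U₀ + h') n) / (β * h') ≤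
      ω.meanEnergy (hubbardTTPrimeFermionInteraction 0 0 1) 1 := by
  have hβh : 0 < β * h' := mul_pos hβ hh
  refine le_of_forall_sub_le fun δ hδ => ?_
  set ε := δ * (β * h') / 2 with hε
  have hεpos : 0 < ε := by positivity
  have hℓ := eventually_sub_mul_sq_le_log_partitionFn_of_le_pressureInfTT' hβ.le t s U₀ hn0 hn2 le_rfl hLs hεpos
  have hu := eventually_log_partitionFn_le_add_mul_sq_of_pressureSupTT'_le hβ.le t s (U₀ + h') hn0 hn2 le_rfl hLs hεpos
  refine ge_of_tendsto (h.tendsto_meanEnergy_hubbardTTPrime 0 0 1 hLs) ?_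
  filter_upwards [hℓ, hu, hLs.eventually_ge_atTop 1] with j hl hu' hj
  haveI : NeZero (Ls j) := ⟨by omega⟩
  have hL2 : (0 : ℝ) < (Ls j : ℝ) ^ 2 := by positivity
  have hb := (log_partitionFn_sector_sub_mem_Icc_U hn0 hn2.le (Ls j) t s β U₀ (U₀ + h')).2
  rw [show U₀ + h' - U₀ = h' by ring] at hb
  set S := ∑ i, sectorGibbsWeightTT' β t s U₀ n (Ls j) i *
    (QuantumLattice.expect (hubbardTorusTT' (Ls j) 0 0 1) (sectorGibbsVectorTT' t s U₀ n (Ls j) i)).re with hS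
  have hsum : ∑ i, sectorGibbsWeightTT' β t s U₀ n (Ls j) i *
      ((QuantumLattice.expect (hubbardTorusTT' (Ls j) 0 0 1) (sectorGibbsVectorTT' t s U₀ n (Ls j) i)).re /
        (Ls j : ℝ) ^ 2) = S / (Ls j : ℝ) ^ 2 := by
    rw [hS, Finset.sum_div]; exact Finset.sum_congr rfl fun i _ => by ring
  clear_value S
  rw [hsum, le_div_iff₀ hL2]
  have e : ((pressureInfTT' β t s U₀ n - pressureSupTT' β t s (U₀ + h') n) / (β * h') - δ) * (Ls j : ℝ) ^ 2 * (β * h') =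
      (pressureInfTT' β t s U₀ n - ε - (pressureSupTT' β t s (U₀ + h') n + ε)) * (Ls j : ℝ) ^ 2 := by
    rw [hε]; field_simp; ring
  have key : ((pressureInfTT' β t s U₀ n - pressureSupTT' β t s (U₀ + h') n) / (β * h') - δ) * (Ls j : ℝ) ^ 2 *
      (β * h') ≤ S * (β * h') := by
    rw [e]
    have : β * (h' * S) = S * (β * h') := by ring
    linarith
  exact le_of_mul_le_mul_right key hβh

/-- **Upper Griffiths bracket in `U`**: `D(ω) ≤ (p⁺(β;t,s,U₀−h;n) − p⁻(β;t,s,U₀;n))/(βh)`.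
[cite: Griffiths1964, §2] [cite: Lieb1973, §V (5.2)–(5.4)] -/
theorem IsTorusLimitOfMixture.docc_le_pressure_slope_of_sectorGibbs (hn0 : 0 ≤ n) (hn2 : n < 2) (hβ : 0 < β)
    (h : ω.IsTorusLimitOfMixture (sectorGibbsCount n) (fun L => sectorGibbsWeightTT' β t s U₀ n L)
      (fun L => sectorGibbsVectorTT' t s U₀ n L) Ls)
    (hLs : Tendsto Ls atTop atTop) {h' : ℝ} (hh : 0 < h') :
    ω.meanEnergy (hubbardTTPrimeFermionInteraction 0 0 1) 1 ≤
      (pressureSupTT' β t s (U₀ - h') n - pressureInfTT' β t s U₀ n) / (β * h') := by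
  have hβh : 0 < β * h' := mul_pos hβ hh
  refine le_of_forall_pos_le_add fun δ hδ => ?_
  set ε := δ * (β * h') / 2 with hε
  have hεpos : 0 < ε := by positivity
  have hℓ := eventually_sub_mul_sq_le_log_partitionFn_of_le_pressureInfTT' hβ.le t s U₀ hn0 hn2 le_rfl hLs hεpos
  have hu := eventually_log_partitionFn_le_add_mul_sq_of_pressureSupTT'_le hβ.le t s (U₀ - h') hn0 hn2 le_rfl hLs hεpos
  refine le_of_tendsto (h.tendsto_meanEnergy_hubbardTTPrime 0 0 1 hLs) ?_
  filter_upwards [hℓ, hu, hLs.eventually_ge_atTop 1] with j hl hu' hj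
  haveI : NeZero (Ls j) := ⟨by omega⟩
  have hL2 : (0 : ℝ) < (Ls j : ℝ) ^ 2 := by positivity
  have hb := (log_partitionFn_sector_sub_mem_Icc_U hn0 hn2.le (Ls j) t s β (U₀ - h') U₀).1
  rw [show U₀ - (U₀ - h') = h' by ring] at hb
  have hsum : ∑ i, sectorGibbsWeightTT' β t s U₀ n (Ls j) i *
      ((QuantumLattice.expect (hubbardTorusTT' (Ls j) 0 0 1) (sectorGibbsVectorTT' t s U₀ n (Ls j) i)).re /
        (Ls j : ℝ) ^ 2) =
      (∑ i, sectorGibbsWeightTT' β t s U₀ n (Ls j) i *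
        (QuantumLattice.expect (hubbardTorusTT' (Ls j) 0 0 1) (sectorGibbsVectorTT' t s U₀ n (Ls j) i)).re) /
        (Ls j : ℝ) ^ 2 := by
    rw [Finset.sum_div]; exact Finset.sum_congr rfl fun i _ => by ring
  rw [hsum, div_le_iff₀ hL2, div_add' _ _ _ hβh.ne', div_mul_eq_mul_div, le_div_iff₀ hβh]
  have e : ε + ε = δ * (β * h') := by rw [hε]; ring
  nlinarith [hb, hl, hu', e]

/-- **THERMAL DOCC WINDOW FROM THREE PRESSURES** (number form, `U₀ ≥ h > 0`, `β > 0`, `0 ≤ n < 2`): for every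
torus limit `ω` at `(β, t, s, U₀)`,
`(p(U₀) − p(U₀+h))/(βh) ≤ Re ω-docc ≤ (p(U₀−h) − p(U₀))/(βh)` with `p = pressureTT' β t s · n`.
[cite: Griffiths1964, §2] [cite: Israel1979, Lemma II.3.1] -/
theorem IsTorusLimitOfMixture.docc_mem_Icc_pressureTT'_slopes_of_sectorGibbs (hn0 : 0 ≤ n) (hn2 : n < 2)
    (hβ : 0 < β)
    (h : ω.IsTorusLimitOfMixture (sectorGibbsCount n) (fun L => sectorGibbsWeightTT' β t s U₀ n L)
      (fun L => sectorGibbsVectorTT' t s U₀ n L) Ls)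
    (hLs : Tendsto Ls atTop atTop) {h' : ℝ} (hh : 0 < h') (hU : h' ≤ U₀) :
    ω.meanEnergy (hubbardTTPrimeFermionInteraction 0 0 1) 1 ∈
      Set.Icc ((pressureTT' β t s U₀ n - pressureTT' β t s (U₀ + h') n) / (β * h'))
        ((pressureTT' β t s (U₀ - h') n - pressureTT' β t s U₀ n) / (β * h')) := by
  have hU₀ : 0 ≤ U₀ := hh.le.trans hU
  constructor
  · rw [← pressureInfTT'_eq_pressureTT' hβ.le t s hU₀ hn0 hn2,
      ← pressureSupTT'_eq_pressureTT' hβ.le t s (by linarith) hn0 hn2]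
    exact h.pressure_slope_le_docc_of_sectorGibbs hn0 hn2 hβ hLs hh
  · rw [← pressureInfTT'_eq_pressureTT' hβ.le t s hU₀ hn0 hn2,
      ← pressureSupTT'_eq_pressureTT' hβ.le t s (sub_nonneg.2 hU) hn0 hn2]
    exact h.docc_le_pressure_slope_of_sectorGibbs hn0 hn2 hβ hLs hh

/-! ### §2 The `t'`-direction: the diagonal kinetic density from three pressures -/

/-- **Lower Griffiths bracket in `t'`**: `(p⁻(β;t,s,U;n) − p⁺(β;t,s+h,U;n))/(βh) ≤ K₂(ω)`,
`K₂(ω) = e_{Φ(0,1,0)}(ω)` the diagonal kinetic density of the torus limit `ω` at `(β, t, s, U)`.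
[cite: Griffiths1964, §2] [cite: Lieb1973, §V (5.2)–(5.4)] -/
theorem IsTorusLimitOfMixture.pressure_slope_le_diagHop_of_sectorGibbs {U : ℝ} (hn0 : 0 ≤ n) (hn2 : n < 2)
    (hβ : 0 < β)
    (h : ω.IsTorusLimitOfMixture (sectorGibbsCount n) (fun L => sectorGibbsWeightTT' β t s U n L)
      (fun L => sectorGibbsVectorTT' t s U n L) Ls)
    (hLs : Tendsto Ls atTop atTop) {h' : ℝ} (hh : 0 < h') :
    (pressureInfTT' β t s U n - pressureSupTT' β t (s + h') U n) / (β * h') ≤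
      ω.meanEnergy (hubbardTTPrimeFermionInteraction 0 1 0) 1 := by
  have hβh : 0 < β * h' := mul_pos hβ hh
  refine le_of_forall_sub_le fun δ hδ => ?_
  set ε := δ * (β * h') / 2 with hε
  have hεpos : 0 < ε := by positivity
  have hℓ := eventually_sub_mul_sq_le_log_partitionFn_of_le_pressureInfTT' hβ.le t s U hn0 hn2 le_rfl hLs hεpos
  have hu := eventually_log_partitionFn_le_add_mul_sq_of_pressureSupTT'_le hβ.le t (s + h') U hn0 hn2 le_rfl hLs hεpos
  refine ge_of_tendsto (h.tendsto_meanEnergy_hubbardTTPrime 0 1 0 hLs) ?_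
  filter_upwards [hℓ, hu, hLs.eventually_ge_atTop 1] with j hl hu' hj
  haveI : NeZero (Ls j) := ⟨by omega⟩
  have hL2 : (0 : ℝ) < (Ls j : ℝ) ^ 2 := by positivity
  have hb := (log_partitionFn_sector_sub_mem_Icc_tPrime hn0 hn2.le (Ls j) t U β s (s + h')).2
  rw [show s + h' - s = h' by ring] at hb
  set S := ∑ i, sectorGibbsWeightTT' β t s U n (Ls j) i *
    (QuantumLattice.expect (hubbardTorusTT' (Ls j) 0 1 0) (sectorGibbsVectorTT' t s U n (Ls j) i)).re with hS
  have hsum : ∑ i, sectorGibbsWeightTT' β t s U n (Ls j) i *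
      ((QuantumLattice.expect (hubbardTorusTT' (Ls j) 0 1 0) (sectorGibbsVectorTT' t s U n (Ls j) i)).re /
        (Ls j : ℝ) ^ 2) = S / (Ls j : ℝ) ^ 2 := by
    rw [hS, Finset.sum_div]; exact Finset.sum_congr rfl fun i _ => by ring
  clear_value S
  rw [hsum, le_div_iff₀ hL2]
  have e : ((pressureInfTT' β t s U n - pressureSupTT' β t (s + h') U n) / (β * h') - δ) * (Ls j : ℝ) ^ 2 * (β * h') =
      (pressureInfTT' β t s U n - ε - (pressureSupTT' β t (s + h') U n + ε)) * (Ls j : ℝ) ^ 2 := by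
    rw [hε]; field_simp; ring
  have key : ((pressureInfTT' β t s U n - pressureSupTT' β t (s + h') U n) / (β * h') - δ) * (Ls j : ℝ) ^ 2 *
      (β * h') ≤ S * (β * h') := by
    rw [e]
    have : β * (h' * S) = S * (β * h') := by ring
    linarith
  exact le_of_mul_le_mul_right key hβh

/-- **Upper Griffiths bracket in `t'`**: `K₂(ω) ≤ (p⁺(β;t,s−h,U;n) − p⁻(β;t,s,U;n))/(βh)`.
[cite: Griffiths1964, §2] [cite: Lieb1973, §V (5.2)–(5.4)] -/
theorem IsTorusLimitOfMixture.diagHop_le_pressure_slope_of_sectorGibbs {U : ℝ} (hn0 : 0 ≤ n) (hn2 : n < 2)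
    (hβ : 0 < β)
    (h : ω.IsTorusLimitOfMixture (sectorGibbsCount n) (fun L => sectorGibbsWeightTT' β t s U n L)
      (fun L => sectorGibbsVectorTT' t s U n L) Ls)
    (hLs : Tendsto Ls atTop atTop) {h' : ℝ} (hh : 0 < h') :
    ω.meanEnergy (hubbardTTPrimeFermionInteraction 0 1 0) 1 ≤
      (pressureSupTT' β t (s - h') U n - pressureInfTT' β t s U n) / (β * h') := by
  have hβh : 0 < β * h' := mul_pos hβ hh
  refine le_of_forall_pos_le_add fun δ hδ => ?_
  set ε := δ * (β * h') / 2 with hε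
  have hεpos : 0 < ε := by positivity
  have hℓ := eventually_sub_mul_sq_le_log_partitionFn_of_le_pressureInfTT' hβ.le t s U hn0 hn2 le_rfl hLs hεpos
  have hu := eventually_log_partitionFn_le_add_mul_sq_of_pressureSupTT'_le hβ.le t (s - h') U hn0 hn2 le_rfl hLs hεpos
  refine le_of_tendsto (h.tendsto_meanEnergy_hubbardTTPrime 0 1 0 hLs) ?_
  filter_upwards [hℓ, hu, hLs.eventually_ge_atTop 1] with j hl hu' hj
  haveI : NeZero (Ls j) := ⟨by omega⟩
  have hL2 : (0 : ℝ) < (Ls j : ℝ) ^ 2 := by positivity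
  have hb := (log_partitionFn_sector_sub_mem_Icc_tPrime hn0 hn2.le (Ls j) t U β (s - h') s).1
  rw [show s - (s - h') = h' by ring] at hb
  have hsum : ∑ i, sectorGibbsWeightTT' β t s U n (Ls j) i *
      ((QuantumLattice.expect (hubbardTorusTT' (Ls j) 0 1 0) (sectorGibbsVectorTT' t s U n (Ls j) i)).re /
        (Ls j : ℝ) ^ 2) =
      (∑ i, sectorGibbsWeightTT' β t s U n (Ls j) i *
        (QuantumLattice.expect (hubbardTorusTT' (Ls j) 0 1 0) (sectorGibbsVectorTT' t s U n (Ls j) i)).re) /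
        (Ls j : ℝ) ^ 2 := by
    rw [Finset.sum_div]; exact Finset.sum_congr rfl fun i _ => by ring
  rw [hsum, div_le_iff₀ hL2, div_add' _ _ _ hβh.ne', div_mul_eq_mul_div, le_div_iff₀ hβh]
  have e : ε + ε = δ * (β * h') := by rw [hε]; ring
  nlinarith [hb, hl, hu', e]

/-- **THERMAL DIAGONAL-KINETIC WINDOW FROM THREE PRESSURES** (number form, `U ≥ 0`, `β > 0`, `h > 0`):
`(p(s) − p(s+h))/(βh) ≤ K₂(ω) ≤ (p(s−h) − p(s))/(βh)`, `p = pressureTT' β t · U n`. [cite: Griffiths1964, §2] -/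
theorem IsTorusLimitOfMixture.diagHop_mem_Icc_pressureTT'_slopes_of_sectorGibbs {U : ℝ} (hU : 0 ≤ U) (hn0 : 0 ≤ n)
    (hn2 : n < 2) (hβ : 0 < β)
    (h : ω.IsTorusLimitOfMixture (sectorGibbsCount n) (fun L => sectorGibbsWeightTT' β t s U n L)
      (fun L => sectorGibbsVectorTT' t s U n L) Ls)
    (hLs : Tendsto Ls atTop atTop) {h' : ℝ} (hh : 0 < h') :
    ω.meanEnergy (hubbardTTPrimeFermionInteraction 0 1 0) 1 ∈
      Set.Icc ((pressureTT' β t s U n - pressureTT' β t (s + h') U n) / (β * h'))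
        ((pressureTT' β t (s - h') U n - pressureTT' β t s U n) / (β * h')) := by
  constructor
  · rw [← pressureInfTT'_eq_pressureTT' hβ.le t s hU hn0 hn2, ← pressureSupTT'_eq_pressureTT' hβ.le t (s + h') hU hn0 hn2]
    exact h.pressure_slope_le_diagHop_of_sectorGibbs hn0 hn2 hβ hLs hh
  · rw [← pressureInfTT'_eq_pressureTT' hβ.le t s hU hn0 hn2, ← pressureSupTT'_eq_pressureTT' hβ.le t (s - h') hU hn0 hn2]
    exact h.diagHop_le_pressure_slope_of_sectorGibbs hn0 hn2 hβ hLs hh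

end InfVolFermionState

/-! ### §3 Pressure tangents: floors move across a coupling cell with a certified slope cap -/

namespace ThermodynamicLimit

/-- The finite-volume thermal mean of `H_L(a,b,c)` in the canonical Gibbs state of `H_L(t,s,U)`, as the real part of
the mixture average of the torus-averaged local density (`L ≥ 3`). [cite: Israel1979, §I.3 eq. (26)] -/
theorem re_sum_torusAvgExpect_meanEnergyObs_eq (β t s U n a b c : ℝ) {L : ℕ} (hL : 3 ≤ L) :
    (∑ i, (sectorGibbsWeightTT' β t s U n L i : ℂ) *
        torusAvgExpect L (thicken ({0} : Finset (Site 2)) 1) ((hubbardTTPrimeFermionInteraction a b c).meanEnergyObs 1)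
          (sectorGibbsVectorTT' t s U n L i)).re =
      (∑ i, sectorGibbsWeightTT' β t s U n L i *
        (QuantumLattice.expect (hubbardTorusTT' L a b c) (sectorGibbsVectorTT' t s U n L i)).re) / (L : ℝ) ^ 2 := by
  rw [Complex.re_sum, Finset.sum_div]
  refine Finset.sum_congr rfl fun i _ => ?_
  rw [torusAvgExpect_hubbardTTPrime_meanEnergyObs a b c hL, ← Complex.ofReal_natCast, ← Complex.ofReal_pow,
    Complex.re_ofReal_mul, Complex.div_ofReal_re]
  ring

/-- **Pressure tangent in `U`, cap side.** If every torus limit of the canonical sector Gibbs states of `H(t,s,U₀)`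
at `(β, n)` has thermal docc `≤ d⁺`, then for every `U ≥ U₀` (`β ≥ 0`, `0 ≤ n < 2`):
`p⁻(β;t,s,U₀;n) − β(U − U₀)·d⁺ ≤ p⁻(β;t,s,U;n)` — a certified pressure FLOOR moves up in `U` at the price of a
certified docc CAP (`log Z_L(U) ≥ log Z_L(U₀) − β(U−U₀)⟨D⟩_{U₀,L}`). [cite: Griffiths1964, §2] [cite: Lieb1973, §V (5.2)–(5.4)] -/
theorem pressureInfTT'_sub_mul_le_pressureInfTT'_of_docc_cap {β : ℝ} (hβ : 0 ≤ β) (t s : ℝ) {n : ℝ} (hn0 : 0 ≤ n)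
    (hn2 : n < 2) {U₀ U : ℝ} (hU : U₀ ≤ U) {dcap : ℝ}
    (hcap : ∀ (ω : InfVolFermionState 2) (Ls : ℕ → ℕ), Tendsto Ls atTop atTop →
      ω.IsTorusLimitOfMixture (sectorGibbsCount n) (fun L => sectorGibbsWeightTT' β t s U₀ n L)
        (fun L => sectorGibbsVectorTT' t s U₀ n L) Ls →
      ω.meanEnergy (hubbardTTPrimeFermionInteraction 0 0 1) 1 ≤ dcap) :
    pressureInfTT' β t s U₀ n - β * (U - U₀) * dcap ≤ pressureInfTT' β t s U n := by
  refine (le_pressureInfTT'_iff hβ t s U hn0 hn2).2 fun ε hε => ?_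
  have hε2 : 0 < ε / 2 := by positivity
  have hW := (le_pressureInfTT'_iff hβ t s U₀ hn0 hn2).1 le_rfl (ε / 2) hε2
  -- the cap on all torus limits is an eventual cap on the finite-volume thermal docc means
  have hδ : 0 < ε / 2 / (β * (U - U₀) + 1) := div_pos hε2 (by nlinarith [mul_nonneg hβ (sub_nonneg.2 hU)])
  have hev := eventually_re_sectorGibbsAvg_le_of_forall_torusLimit t s U₀ hn0 hn2.le β
    (thicken ({0} : Finset (Site 2)) 1) ((hubbardTTPrimeFermionInteraction 0 0 1).meanEnergyObs 1) (b := dcap)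
    (fun ω Ls hLs hω => hcap ω Ls hLs hω) hδ
  filter_upwards [hW, hev, eventually_ge_atTop 3] with L hWL hcapL hL3
  haveI : NeZero L := ⟨by omega⟩
  have hL2 : (0 : ℝ) < (L : ℝ) ^ 2 := by positivity
  rw [re_sum_torusAvgExpect_meanEnergyObs_eq β t s U₀ n 0 0 1 hL3, div_le_iff₀ hL2] at hcapL
  have hb := (log_partitionFn_sector_sub_mem_Icc_U hn0 hn2.le L t s β U₀ U).2
  have hK : 0 ≤ β * (U - U₀) := mul_nonneg hβ (sub_nonneg.2 hU)
  have h1 : β * ((U - U₀) * ∑ i, sectorGibbsWeightTT' β t s U₀ n L i *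
      (QuantumLattice.expect (hubbardTorusTT' L 0 0 1) (sectorGibbsVectorTT' t s U₀ n L i)).re) ≤
      β * (U - U₀) * ((dcap + ε / 2 / (β * (U - U₀) + 1)) * (L : ℝ) ^ 2) := by
    rw [mul_assoc]
    exact mul_le_mul_of_nonneg_left (mul_le_mul_of_nonneg_left hcapL (sub_nonneg.2 hU)) hβ
  have h2 : β * (U - U₀) * (ε / 2 / (β * (U - U₀) + 1)) ≤ ε / 2 := by
    rw [mul_div_assoc']
    exact (div_le_iff₀ (by linarith)).2 (by nlinarith [hε2.le])
  have h3 : β * (U - U₀) * (ε / 2 / (β * (U - U₀) + 1)) * (L : ℝ) ^ 2 ≤ ε / 2 * (L : ℝ) ^ 2 :=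
    mul_le_mul_of_nonneg_right h2 hL2.le
  nlinarith [hb, hWL, h1, h3]

/-- **Pressure tangent in `U`, floor side.** If every torus limit at `U₀` has thermal docc `≥ d⁻`, then for every
`U ≤ U₀`: `p⁻(β;t,s,U₀;n) + β(U₀ − U)·d⁻ ≤ p⁻(β;t,s,U;n)` (`log Z_L(U) ≥ log Z_L(U₀) + β(U₀−U)⟨D⟩_{U₀,L}`).
[cite: Griffiths1964, §2] [cite: Lieb1973, §V (5.2)–(5.4)] -/
theorem pressureInfTT'_add_mul_le_pressureInfTT'_of_docc_floor {β : ℝ} (hβ : 0 ≤ β) (t s : ℝ) {n : ℝ} (hn0 : 0 ≤ n)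
    (hn2 : n < 2) {U₀ U : ℝ} (hU : U ≤ U₀) {dfl : ℝ}
    (hfloor : ∀ (ω : InfVolFermionState 2) (Ls : ℕ → ℕ), Tendsto Ls atTop atTop →
      ω.IsTorusLimitOfMixture (sectorGibbsCount n) (fun L => sectorGibbsWeightTT' β t s U₀ n L)
        (fun L => sectorGibbsVectorTT' t s U₀ n L) Ls →
      dfl ≤ ω.meanEnergy (hubbardTTPrimeFermionInteraction 0 0 1) 1) :
    pressureInfTT' β t s U₀ n + β * (U₀ - U) * dfl ≤ pressureInfTT' β t s U n := by
  refine (le_pressureInfTT'_iff hβ t s U hn0 hn2).2 fun ε hε => ?_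
  have hε2 : 0 < ε / 2 := by positivity
  have hW := (le_pressureInfTT'_iff hβ t s U₀ hn0 hn2).1 le_rfl (ε / 2) hε2
  have hδ : 0 < ε / 2 / (β * (U₀ - U) + 1) := div_pos hε2 (by nlinarith [mul_nonneg hβ (sub_nonneg.2 hU)])
  have hev := eventually_re_sectorGibbsAvg_ge_of_forall_torusLimit t s U₀ hn0 hn2.le β
    (thicken ({0} : Finset (Site 2)) 1) ((hubbardTTPrimeFermionInteraction 0 0 1).meanEnergyObs 1) (b := dfl)
    (fun ω Ls hLs hω => hfloor ω Ls hLs hω) hδ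
  filter_upwards [hW, hev, eventually_ge_atTop 3] with L hWL hflL hL3
  haveI : NeZero L := ⟨by omega⟩
  have hL2 : (0 : ℝ) < (L : ℝ) ^ 2 := by positivity
  rw [re_sum_torusAvgExpect_meanEnergyObs_eq β t s U₀ n 0 0 1 hL3, le_div_iff₀ hL2] at hflL
  have hb := (log_partitionFn_sector_sub_mem_Icc_U hn0 hn2.le L t s β U U₀).1
  have hK : 0 ≤ β * (U₀ - U) := mul_nonneg hβ (sub_nonneg.2 hU)
  have h1 : β * (U₀ - U) * ((dfl - ε / 2 / (β * (U₀ - U) + 1)) * (L : ℝ) ^ 2) ≤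
      β * ((U₀ - U) * ∑ i, sectorGibbsWeightTT' β t s U₀ n L i *
        (QuantumLattice.expect (hubbardTorusTT' L 0 0 1) (sectorGibbsVectorTT' t s U₀ n L i)).re) := by
    rw [mul_assoc]
    exact mul_le_mul_of_nonneg_left (mul_le_mul_of_nonneg_left hflL (sub_nonneg.2 hU)) hβ
  have h2 : β * (U₀ - U) * (ε / 2 / (β * (U₀ - U) + 1)) ≤ ε / 2 := by
    rw [mul_div_assoc']
    exact (div_le_iff₀ (by linarith)).2 (by nlinarith [hε2.le])
  have h3 : β * (U₀ - U) * (ε / 2 / (β * (U₀ - U) + 1)) * (L : ℝ) ^ 2 ≤ ε / 2 * (L : ℝ) ^ 2 :=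
    mul_le_mul_of_nonneg_right h2 hL2.le
  nlinarith [hb, hWL, h1, h3]

/-- **Pressure tangent in `t'`, cap side**: a `K₂`-cap `e_{Φ(0,1,0)}(ω) ≤ k⁺` on every torus limit at `s₀` gives
`p⁻(β;t,s₀,U;n) − β(s − s₀)·k⁺ ≤ p⁻(β;t,s,U;n)` for `s ≥ s₀`. [cite: Griffiths1964, §2] [cite: Lieb1973, §V (5.2)–(5.4)] -/
theorem pressureInfTT'_sub_mul_le_pressureInfTT'_of_diagHop_cap {β : ℝ} (hβ : 0 ≤ β) (t U : ℝ) {n : ℝ} (hn0 : 0 ≤ n)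
    (hn2 : n < 2) {s₀ s : ℝ} (hs : s₀ ≤ s) {kcap : ℝ}
    (hcap : ∀ (ω : InfVolFermionState 2) (Ls : ℕ → ℕ), Tendsto Ls atTop atTop →
      ω.IsTorusLimitOfMixture (sectorGibbsCount n) (fun L => sectorGibbsWeightTT' β t s₀ U n L)
        (fun L => sectorGibbsVectorTT' t s₀ U n L) Ls →
      ω.meanEnergy (hubbardTTPrimeFermionInteraction 0 1 0) 1 ≤ kcap) :
    pressureInfTT' β t s₀ U n - β * (s - s₀) * kcap ≤ pressureInfTT' β t s U n := by
  refine (le_pressureInfTT'_iff hβ t s U hn0 hn2).2 fun ε hε => ?_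
  have hε2 : 0 < ε / 2 := by positivity
  have hW := (le_pressureInfTT'_iff hβ t s₀ U hn0 hn2).1 le_rfl (ε / 2) hε2
  have hδ : 0 < ε / 2 / (β * (s - s₀) + 1) := div_pos hε2 (by nlinarith [mul_nonneg hβ (sub_nonneg.2 hs)])
  have hev := eventually_re_sectorGibbsAvg_le_of_forall_torusLimit t s₀ U hn0 hn2.le β
    (thicken ({0} : Finset (Site 2)) 1) ((hubbardTTPrimeFermionInteraction 0 1 0).meanEnergyObs 1) (b := kcap)
    (fun ω Ls hLs hω => hcap ω Ls hLs hω) hδ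
  filter_upwards [hW, hev, eventually_ge_atTop 3] with L hWL hcapL hL3
  haveI : NeZero L := ⟨by omega⟩
  have hL2 : (0 : ℝ) < (L : ℝ) ^ 2 := by positivity
  rw [re_sum_torusAvgExpect_meanEnergyObs_eq β t s₀ U n 0 1 0 hL3, div_le_iff₀ hL2] at hcapL
  have hb := (log_partitionFn_sector_sub_mem_Icc_tPrime hn0 hn2.le L t U β s₀ s).2
  have h1 : β * ((s - s₀) * ∑ i, sectorGibbsWeightTT' β t s₀ U n L i *
      (QuantumLattice.expect (hubbardTorusTT' L 0 1 0) (sectorGibbsVectorTT' t s₀ U n L i)).re) ≤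
      β * (s - s₀) * ((kcap + ε / 2 / (β * (s - s₀) + 1)) * (L : ℝ) ^ 2) := by
    rw [mul_assoc]
    exact mul_le_mul_of_nonneg_left (mul_le_mul_of_nonneg_left hcapL (sub_nonneg.2 hs)) hβ
  have h2 : β * (s - s₀) * (ε / 2 / (β * (s - s₀) + 1)) ≤ ε / 2 := by
    rw [mul_div_assoc']
    exact (div_le_iff₀ (by nlinarith [mul_nonneg hβ (sub_nonneg.2 hs)])).2 (by nlinarith [hε2.le])
  have h3 : β * (s - s₀) * (ε / 2 / (β * (s - s₀) + 1)) * (L : ℝ) ^ 2 ≤ ε / 2 * (L : ℝ) ^ 2 :=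
    mul_le_mul_of_nonneg_right h2 hL2.le
  nlinarith [hb, hWL, h1, h3]

/-- **Pressure tangent in `t'`, floor side**: a `K₂`-floor `k⁻ ≤ e_{Φ(0,1,0)}(ω)` on every torus limit at `s₀` gives
`p⁻(β;t,s₀,U;n) + β(s₀ − s)·k⁻ ≤ p⁻(β;t,s,U;n)` for `s ≤ s₀`. [cite: Griffiths1964, §2] [cite: Lieb1973, §V (5.2)–(5.4)] -/
theorem pressureInfTT'_add_mul_le_pressureInfTT'_of_diagHop_floor {β : ℝ} (hβ : 0 ≤ β) (t U : ℝ) {n : ℝ}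
    (hn0 : 0 ≤ n) (hn2 : n < 2) {s₀ s : ℝ} (hs : s ≤ s₀) {kfl : ℝ}
    (hfloor : ∀ (ω : InfVolFermionState 2) (Ls : ℕ → ℕ), Tendsto Ls atTop atTop →
      ω.IsTorusLimitOfMixture (sectorGibbsCount n) (fun L => sectorGibbsWeightTT' β t s₀ U n L)
        (fun L => sectorGibbsVectorTT' t s₀ U n L) Ls →
      kfl ≤ ω.meanEnergy (hubbardTTPrimeFermionInteraction 0 1 0) 1) :
    pressureInfTT' β t s₀ U n + β * (s₀ - s) * kfl ≤ pressureInfTT' β t s U n := by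
  refine (le_pressureInfTT'_iff hβ t s U hn0 hn2).2 fun ε hε => ?_
  have hε2 : 0 < ε / 2 := by positivity
  have hW := (le_pressureInfTT'_iff hβ t s₀ U hn0 hn2).1 le_rfl (ε / 2) hε2
  have hδ : 0 < ε / 2 / (β * (s₀ - s) + 1) := div_pos hε2 (by nlinarith [mul_nonneg hβ (sub_nonneg.2 hs)])
  have hev := eventually_re_sectorGibbsAvg_ge_of_forall_torusLimit t s₀ U hn0 hn2.le β
    (thicken ({0} : Finset (Site 2)) 1) ((hubbardTTPrimeFermionInteraction 0 1 0).meanEnergyObs 1) (b := kfl)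
    (fun ω Ls hLs hω => hfloor ω Ls hLs hω) hδ
  filter_upwards [hW, hev, eventually_ge_atTop 3] with L hWL hflL hL3
  haveI : NeZero L := ⟨by omega⟩
  have hL2 : (0 : ℝ) < (L : ℝ) ^ 2 := by positivity
  rw [re_sum_torusAvgExpect_meanEnergyObs_eq β t s₀ U n 0 1 0 hL3, le_div_iff₀ hL2] at hflL
  have hb := (log_partitionFn_sector_sub_mem_Icc_tPrime hn0 hn2.le L t U β s s₀).1
  have h1 : β * (s₀ - s) * ((kfl - ε / 2 / (β * (s₀ - s) + 1)) * (L : ℝ) ^ 2) ≤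
      β * ((s₀ - s) * ∑ i, sectorGibbsWeightTT' β t s₀ U n L i *
        (QuantumLattice.expect (hubbardTorusTT' L 0 1 0) (sectorGibbsVectorTT' t s₀ U n L i)).re) := by
    rw [mul_assoc]
    exact mul_le_mul_of_nonneg_left (mul_le_mul_of_nonneg_left hflL (sub_nonneg.2 hs)) hβ
  have h2 : β * (s₀ - s) * (ε / 2 / (β * (s₀ - s) + 1)) ≤ ε / 2 := by
    rw [mul_div_assoc']
    exact (div_le_iff₀ (by nlinarith [mul_nonneg hβ (sub_nonneg.2 hs)])).2 (by nlinarith [hε2.le])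
  have h3 : β * (s₀ - s) * (ε / 2 / (β * (s₀ - s) + 1)) * (L : ℝ) ^ 2 ≤ ε / 2 * (L : ℝ) ^ 2 :=
    mul_le_mul_of_nonneg_right h2 hL2.le
  nlinarith [hb, hWL, h1, h3]

/-- **Number form of the `U`-tangent, cap side** (`β ≥ 0`, `0 ≤ U₀ ≤ U`, `0 ≤ n < 2`):
`p(β;t,s,U₀;n) − β(U − U₀)·d⁺ ≤ p(β;t,s,U;n)`, `p = pressureTT'`. [cite: Griffiths1964, §2] -/
theorem pressureTT'_sub_mul_le_pressureTT'_of_docc_cap {β : ℝ} (hβ : 0 ≤ β) (t s : ℝ) {n : ℝ} (hn0 : 0 ≤ n)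
    (hn2 : n < 2) {U₀ U : ℝ} (hU₀ : 0 ≤ U₀) (hU : U₀ ≤ U) {dcap : ℝ}
    (hcap : ∀ (ω : InfVolFermionState 2) (Ls : ℕ → ℕ), Tendsto Ls atTop atTop →
      ω.IsTorusLimitOfMixture (sectorGibbsCount n) (fun L => sectorGibbsWeightTT' β t s U₀ n L)
        (fun L => sectorGibbsVectorTT' t s U₀ n L) Ls →
      ω.meanEnergy (hubbardTTPrimeFermionInteraction 0 0 1) 1 ≤ dcap) :
    pressureTT' β t s U₀ n - β * (U - U₀) * dcap ≤ pressureTT' β t s U n := by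
  rw [← pressureInfTT'_eq_pressureTT' hβ t s hU₀ hn0 hn2, ← pressureInfTT'_eq_pressureTT' hβ t s (hU₀.trans hU) hn0 hn2]
  exact pressureInfTT'_sub_mul_le_pressureInfTT'_of_docc_cap hβ t s hn0 hn2 hU hcap

/-- **Number form of the `U`-tangent, floor side** (`0 ≤ U ≤ U₀`): `p(U₀) + β(U₀ − U)·d⁻ ≤ p(U)`.
[cite: Griffiths1964, §2] -/
theorem pressureTT'_add_mul_le_pressureTT'_of_docc_floor {β : ℝ} (hβ : 0 ≤ β) (t s : ℝ) {n : ℝ} (hn0 : 0 ≤ n)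
    (hn2 : n < 2) {U₀ U : ℝ} (hUnn : 0 ≤ U) (hU : U ≤ U₀) {dfl : ℝ}
    (hfloor : ∀ (ω : InfVolFermionState 2) (Ls : ℕ → ℕ), Tendsto Ls atTop atTop →
      ω.IsTorusLimitOfMixture (sectorGibbsCount n) (fun L => sectorGibbsWeightTT' β t s U₀ n L)
        (fun L => sectorGibbsVectorTT' t s U₀ n L) Ls →
      dfl ≤ ω.meanEnergy (hubbardTTPrimeFermionInteraction 0 0 1) 1) :
    pressureTT' β t s U₀ n + β * (U₀ - U) * dfl ≤ pressureTT' β t s U n := by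
  rw [← pressureInfTT'_eq_pressureTT' hβ t s (hUnn.trans hU) hn0 hn2, ← pressureInfTT'_eq_pressureTT' hβ t s hUnn hn0 hn2]
  exact pressureInfTT'_add_mul_le_pressureInfTT'_of_docc_floor hβ t s hn0 hn2 hU hfloor

end ThermodynamicLimit

end Literature.MathematicalPhysics.QuantumLattice
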